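import Summits.BirchSwinnertonDyer.BirchSwinnertonDyer.Theses.SignedLowerHalves
import Summits.BirchSwinnertonDyer.BirchSwinnertonDyer.Theorems.SignedLowerHalvesSmallImageMuZeroOneSignMuControl
import Summits.BirchSwinnertonDyer.BirchSwinnertonDyer.Theorems.SignedLowerHalvesSmallImageMuZeroOneSignFinePivotOneSign
import HarnessLib

/-!
# Line `birth_mu` v3 — crux M `SmallImageMuZeroOneSign` (route `SignedLowerHalves` (K3), crux rank 402;
# item stmt-BirchSwinnertonDyer-23600): Kobayashi's `μ`-conjecture for ONE sign at every small-image supersingular X7 pair —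
# «some `ε` with `μ(ξ) = 0` for every characteristic power series `ξ` of every key-`γ` signed Selmer dual datum of sign `ε`»
# (ALGEBRAIC `μ`).  LEAD seat `cruxlead-stmt-BirchSwinnertonDyer-23600`; v1/v2 gen 0 (director-bsd (314)(1)), v3 gen 2 (the FINE PIVOT).

THE LINE (v3).  Two routes to M's body at a pair, composed by `p = 3` / `p ≥ 5`:

* `p = 3` (UNCHANGED from v2, all LANDED, print only): the brick `stub_muControl_ns` (lane B's Euler-system `μ`-transfer at
  non-surjective image: a unit coefficient of `L_p^{ε₀}(E)` ⟹ algebraic `μ(X^{ε₀}) = 0`) and the input-free rider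
  `stub_muAnOneSignThree_ns` (THEOREM B at `p = 3`, `min(μ(L₃⁺), μ(L₃⁻)) = 0`), both the registered-by-name theorems of
  `Theorems/SignedLowerHalvesSmallImageMuZeroOneSignMuControl.lean` (p683375 + p683745); binders `stub_printedInputsMu_ns` (HELD:
  hCK ∧ h12 ∧ h5 ∧ h3 ∧ hmodP).
* `p ≥ 5` (NEW in v3 — the FINE PIVOT, crux idea «fine-pivot-minsign», bsd-idea-5 g10, item evidence #5–#8): the brick
  `stub_minSignAbsorption_ns` = «Coates–Sujatha's Conjecture A at the pair (`Rank1Residual.ConjAAt W p`) ⟹ M's body at the pair»,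
  PROVED in the kernel by the RESIDUAL corank count (`Theorems/…FinePivotLengths` / `…Dichotomy` / `…FinePivot` / `…FinePivotOneSign`,
  LEAD g2: inside `X = Sel_{p^∞}(E/ℚ_∞)^∨ ⊇` the duals of `Sel^±`, `ℓ_{(p)}(X/pX) ≤ 1` by Kurihara–Pollack's extension
  `0 → Λ²/Λv → X → X₀ → 0` + Wingberg/Matar `ℓ_{(p)}(tors X) = ℓ_{(p)}(X₀) = 0`, `(Sel⁺ ∩ Sel⁻)[p]` finite by
  `C⁺ ∩ C⁻ = E(ℚ_p) ⊗ ℚ_p/ℤ_p`, and `ann(A ∩ B) = ann A + ann B` ⟹ `Sel⁺[p]` or `Sel⁻[p]` finite ⟹ `μ(X^ε) = 0` for one `ε`,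
  moved to every cyclotomic datum by `exists_addEquiv_signedSelmerInfty_of_isCyclotomic`; NO `L_p`, NO main conjecture, NO image
  hypothesis); binders `stub_printedInputsFine_ns` (HELD: the two Kurihara–Pollack 2007 sentences typed by this seat,
  `kuriharaPollack2007_selmerDual_extension_of_fineDual` (§3 p. 328) and `signedSelmerInf_sub_fineSelmer_of_loc`
  (§1.2 p. 310), and the tree's `matar2020_thm11_selmerDualTorsion_pseudoIso_fineSelmerDual`); and the ONE OPEN stub
  `stub_conjA_ns_ge5` = Conjecture A on the crux's domain at `p ≥ 5` — OPEN in print (Coates–Sujatha 2005 Conjecture A; implied by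
  Iwasawa's classical `μ = 0` for `ℚ(E[p])^{cyc}`, CS05 Thm. 3.4, a `K`-abelian field with `p` inert in `K`; per pair certifiable by
  class groups, tree doors `fineSelmerDual_moduleFinite_of_not_dvd_classNumber_of_unique_prime` etc.).

v3 − v2 (2026-08-29T0x, LEAD gen 2): the v2 open stub `stub_muAnOneSignGeFive_ns` (= retired 23117, the one-signed ANALYTIC `μ` on the
K-dihedral class — crux-sized, «non-split Gillard») is RETIRED from the line and replaced by the pair {`stub_minSignAbsorption_ns` (LANDED),
`stub_conjA_ns_ge5` (OPEN)}.  The replacement is STRICTLY WEAKER and EXACT: 23117 at a pair ⟹ Conjecture A at the pair (lane B,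
`CoreAssembly.coreOdd_anyReduction_holds`), and conversely M's body at a pair ⟹ the fine `μ = 0` at the pair
(`SmallImageFinePivot.fineMuZeroAt_of_oneSignMuZero`, mod Kobayashi Thm. 1.2) — so modulo print **M ⟺ Conjecture A (μ-form) on the
class**: the open stub IS the crux's irreducible content, sign-free and `L`-function-free.

STUBS (5 ≤ stubs_max): `stub_printedInputsMu_ns` (HELD) · `stub_muControl_ns` (LANDED p683745) · `stub_muAnOneSignThree_ns` (LANDED
p683745) · `stub_printedInputsFine_ns` (HELD) · `stub_minSignAbsorption_ns` (LANDED, by name, `Theorems/…FinePivotStubs.lean`) ·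
`stub_conjA_ns_ge5` (OPEN, conjecture-grade).  Composition `SmallImageMuZeroOneSign_of` (no sorry of its own) concludes the route decl BY NAME.

HONEST: crux M (p ≥ 5), crux 4 and BSD are OPEN / not proved by this seat; nothing here asserts the held facts or Conjecture A.
READING FOR THE PEN (D-0014): M ⟸ print ∧ Conj A|_{class, p ≥ 5}; M ⟹ Conj A (μ-form)|_{class} mod print; M at `p = 3` ⟸ print alone.
Falsifier of the open stub: ONE small-image pair, `p ≥ 5`, with `μ(X₀(E/ℚ_∞)) > 0` (⟺ both `μ(X⁺) > 0` and `μ(X⁻) > 0` by this line).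
-/

set_option autoImplicit false
set_option linter.dupNamespace false

noncomputable section

open scoped Classical MatrixGroups ModularForm

namespace Summit.BirchSwinnertonDyer.BirchSwinnertonDyer.Cruxes.SmallImageMuZeroOneSign.BirthMu

open CongruenceSubgroup Literature.NumberTheory.EllipticCurves Literature.NumberTheory.EllipticCurves.Rank1Residual
  Literature.NumberTheory.EllipticCurves.ModularForms Literature.NumberTheory.EllipticCurves.Kobayashi2003
  Literature.NumberTheory.EllipticCurves.GreenbergVatsal2000
  Summit.BirchSwinnertonDyer.Rank1Residual.Supersingular
  Summit.BirchSwinnertonDyer.Rank1Residual.X1.MuLambda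

/-- stub (HELD, cite-only — PUBLISHED named facts, none with `_holds`; never a prover target; UNCHANGED from v1/v2): the
Coleman–Kato `ζ`-construction fact (Kobayashi 2003 Thm. 6.2/6.3/7.3), Kobayashi Thm. 1.2, the period units at `p ≥ 5` / `p = 3`,
modularity with parametrisation.  Used on the `p = 3` rows only (v3).
[cite: Kobayashi2003, Thm. 1.2 (p. 2), Thm. 6.2–6.3 (p. 11), Thm. 7.3 (p. 13)] [cite: GreenbergVatsal2000, §3, Remark 3.4]
[cite: Mazur1978, Cor. 4.1] [cite: BCDTJAMS2001, Theorem A] -/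
theorem stub_printedInputsMu_ns :
    Literature.NumberTheory.EllipticCurves.Kobayashi2003.thm62_63_73_signedColemanKato_zeta ∧
    Literature.NumberTheory.EllipticCurves.Kobayashi2003.thm12_signedSelmerDual_finite_torsion ∧
    Literature.NumberTheory.EllipticCurves.realPeriodRat_eq_unit_mul_plusPeriod ∧
    Literature.NumberTheory.EllipticCurves.realPeriodRat_eq_unit_mul_plusPeriod_three ∧
    Literature.NumberTheory.EllipticCurves.ModularForms.nonempty_modularParametrizationData := by
  sorry

/-- stub `stub_muControl_ns` — the v1 brick (LANDED p683745, by name; unchanged). [cite: Kobayashi2003, Thm. 1.2, Thm. 6.2–6.3, Thm. 7.3 (7.21)]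
[cite: Kato2004Asterisque, Thm. 12.6 (p. 222), §13.8 (pp. 228–229)] -/
theorem stub_muControl_ns :
    (Literature.NumberTheory.EllipticCurves.Kobayashi2003.thm62_63_73_signedColemanKato_zeta ∧
      Literature.NumberTheory.EllipticCurves.Kobayashi2003.thm12_signedSelmerDual_finite_torsion ∧
      Literature.NumberTheory.EllipticCurves.realPeriodRat_eq_unit_mul_plusPeriod ∧
      Literature.NumberTheory.EllipticCurves.realPeriodRat_eq_unit_mul_plusPeriod_three) →
    ∀ (W : WeierstrassCurve ℚ) [W.IsElliptic] [W.IsGloballyMinimal] (p : ℕ) [Fact p.Prime],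
      p ≠ 2 → ClassX7 W p → ¬ W.HasCM → W.frobeniusTrace p = 0 → ¬ Surj W p →
      ∀ [NeZero (W.conductorNorm ℤ)] (f : CuspForm (Gamma0 (W.conductorNorm ℤ)) 2), IsNewformOf W f →
      ∀ (ε : ℤˣ) (L₀ : IwasawaAlgebra p), IsSignedPAdicLFunction f p ε L₀ → HasUnitContent L₀ →
      ∀ (κ : ZpExtension ℚ p) (γ : Field.absoluteGaloisGroup ℚ), κ.IsCyclotomic → κ.IsTopGenerator γ →
        IsCyclotomicVariable p γ → ∀ (D : SignedSelmerDualData W κ γ ε) (ξ : IwasawaAlgebra p),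
          D.charIdeal = Ideal.span {ξ} → mu ξ = 0 :=
  Summit.BirchSwinnertonDyer.BirchSwinnertonDyer.Theorems.SmallImageMuControl.stub_muControl_ns

/-- stub `stub_muAnOneSignThree_ns` — the `p = 3` rider (LANDED p683745, by name; unchanged; input-free THEOREM B at `p = 3`).
[cite: PollackWeston2011, Thm. 4.1 (1), Rem. 4.2] [cite: Vaserstein1972SL2, Theorem] [cite: Pollack2003, Thm. 5.6, Prop. 6.18] -/
theorem stub_muAnOneSignThree_ns : ∀ (W : WeierstrassCurve ℚ) [W.IsElliptic] [W.IsGloballyMinimal] (p : ℕ) [Fact p.Prime],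
    p = 3 → ClassX7 W p → ¬ W.HasCM → W.frobeniusTrace p = 0 → ¬ Surj W p →
    ∀ [NeZero (W.conductorNorm ℤ)] (f : CuspForm (Gamma0 (W.conductorNorm ℤ)) 2),
    IsNewformOf W f → ∃ (ε₀ : ℤˣ) (L₀ : IwasawaAlgebra p),
      IsSignedPAdicLFunction f p ε₀ L₀ ∧ HasUnitContent L₀ :=
  Summit.BirchSwinnertonDyer.BirchSwinnertonDyer.Theorems.SmallImageMuControl.stub_muAnOneSignThree_ns

/-- stub (HELD, cite-only — PUBLISHED named facts, none with `_holds`; never a prover target; NEW in v3): the two Kurihara–Pollack 2007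
sentences typed by this seat (§3 p. 328: `0 → H¹_loc/H¹_glob → Sel(E/ℚ_∞)^∨ → Sel₀(E/ℚ_∞)^∨ → 0` with `H¹_glob ≅ Λ`, `H¹_loc ≅ Λ ⊕ Λ`;
§1.2 p. 310: `C⁺ ∩ C⁻ = E(ℚ_p) ⊗ ℚ_p/ℤ_p`, read on the Selmer groups) and Matar 2020 Thm. 1.1 / Wingberg 1989 Cor. 2.5
(`tors X(E/ℚ_∞) ∼ X₀(E/ℚ_∞)^ι`).  Used on the `p ≥ 5` rows.
[cite: KuriharaPollack2007, §1.2 Prop. 1.2 (p. 310), §3 proof of Prop. 3.4 (1) (p. 328)] [cite: Matar2020, Thm. 1.1] [cite: Wingberg1989, Cor. 2.5] -/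
theorem stub_printedInputsFine_ns :
    Literature.NumberTheory.EllipticCurves.kuriharaPollack2007_selmerDual_extension_of_fineDual ∧
    Literature.NumberTheory.EllipticCurves.signedSelmerInf_sub_fineSelmer_of_loc ∧
    Literature.NumberTheory.EllipticCurves.matar2020_thm11_selmerDualTorsion_pseudoIso_fineSelmerDual := by
  sorry

/-- stub `stub_minSignAbsorption_ns` — THE v3 BRICK (the fine pivot, PROVED by the lead, landed by name): GRANTED the three printed
binders (antecedent), at every pair of crux M's domain (odd `p`, `ClassX7`, non-CM, `a_p = 0`, `¬ Surj`), Coates–Sujatha's Conjecture A at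
the pair (`ConjAAt W p`: over every cyclotomic `κ` SOME dual fine Selmer datum is finitely generated over `ℤ_p`) gives M's body at the
pair: SOME sign `ε` with `μ(ξ) = 0` for every key-`γ` Pontryagin dual datum of `Sel^ε(E/ℚ_∞)` over every cyclotomic datum and every
characteristic power series `ξ`.  Mechanism: residual corank count (module docstring).  (The domain hypotheses `ClassX7`, `¬CM`, `¬Surj`
are idle in the proof — it holds at every odd good `p` with `a_p = 0`.)  Kernel theorem
`SmallImageFinePivot.oneSignMuZero_of_conjAAt`. [cite: CoatesSujatha2005, §3 Conjecture A] [cite: KuriharaPollack2007, §1.2, §3 p. 328]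
[cite: Matar2020, Thm. 1.1] [cite: Kobayashi2003, Def. 1.1, Thm. 7.3] -/
theorem stub_minSignAbsorption_ns :
    (Literature.NumberTheory.EllipticCurves.kuriharaPollack2007_selmerDual_extension_of_fineDual ∧
      Literature.NumberTheory.EllipticCurves.signedSelmerInf_sub_fineSelmer_of_loc ∧
      Literature.NumberTheory.EllipticCurves.matar2020_thm11_selmerDualTorsion_pseudoIso_fineSelmerDual) →
    ∀ (W : WeierstrassCurve ℚ) [W.IsElliptic] [W.IsGloballyMinimal] (p : ℕ) [Fact p.Prime],
      p ≠ 2 → ClassX7 W p → ¬ W.HasCM → W.frobeniusTrace p = 0 → ¬ Surj W p → ConjAAt W p →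
      ∃ ε : ℤˣ, ∀ (κ : ZpExtension ℚ p) (γ : Field.absoluteGaloisGroup ℚ), κ.IsCyclotomic → κ.IsTopGenerator γ →
        IsCyclotomicVariable p γ → ∀ (D : SignedSelmerDualData W κ γ ε) (ξ : IwasawaAlgebra p),
          D.charIdeal = Ideal.span {ξ} → mu ξ = 0 :=
  fun h W _ _ p _ hp hX _ hap _ hA ↦
    Summit.BirchSwinnertonDyer.BirchSwinnertonDyer.Theorems.SmallImageFinePivot.oneSignMuZero_of_conjAAt
      h.1 h.2.1 h.2.2 W hp hX.1.1 hap hA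

/-- stub `stub_conjA_ns_ge5` — THE ONE OPEN STUB of v3 (conjecture-grade; the crux's irreducible content): Coates–Sujatha's CONJECTURE A at
every small-image supersingular X7 pair with `p ≥ 5` (good supersingular `p ≥ 5`, `ClassX7`, non-CM, `a_p = 0`, `ρ̄_{E,p}` not onto —
i.e. `im ρ̄ = N(C_ns(p))`, `ρ̄ ≅ Ind_K ψ̄`, `p` inert in the imaginary quadratic `K`; infinite families at `p ∈ {5, 7, 11}`): over every
cyclotomic `κ`, SOME Pontryagin dual datum of `Sel₀(ℚ_∞, E[p^∞])` is finitely generated over `ℤ_p` (`Rank1Residual.ConjAAt W p`).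
OPEN in print [Coates–Sujatha 2005 §3 Conjecture A]; implied by Iwasawa's classical `μ = 0` conjecture for the cyclotomic
`ℤ_p`-extension of `ℚ(E[p]) = K(ψ̄)` (CS05 Thm. 3.4; a `K`-abelian number field, `p` inert — the cyclotomic-line analogue of Gillard's
theorem, open); implied at a pair by the one-signed analytic rider (retired 23117) through lane B's primitive Kato class; per pair
certifiable by class groups (tree doors `FineSelmerMuRoadDoors`).  EQUIVALENT to crux M on the domain modulo print
(`SmallImageFinePivot.fineMuZeroAt_of_oneSignMuZero` for the converse).  Falsifier: ONE such pair with `μ(X₀(E/ℚ_∞)) > 0`.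
[cite: CoatesSujatha2005, §3 Conjecture A and Thm. 3.4] [cite: Kobayashi2003, p. 35] [cite: PollackWeston2011, Rem. 4.2 (arXiv:0906.1741 p. 10)] -/
theorem stub_conjA_ns_ge5 : ∀ (W : WeierstrassCurve ℚ) [W.IsElliptic] [W.IsGloballyMinimal] (p : ℕ) [Fact p.Prime],
    5 ≤ p → ClassX7 W p → ¬ W.HasCM → W.frobeniusTrace p = 0 → ¬ Surj W p → ConjAAt W p := by
  sorry

/-- **M's body at every pair with `p ≥ 5`** from the fine-pivot brick, its printed binders and the open stub. No sorry of its own.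
[cite: CoatesSujatha2005, §3 Conjecture A] -/
theorem muZeroOneSign_ge_five_of_stubs : ∀ (W : WeierstrassCurve ℚ) [W.IsElliptic] [W.IsGloballyMinimal] (p : ℕ) [Fact p.Prime],
    5 ≤ p → ClassX7 W p → ¬ W.HasCM → W.frobeniusTrace p = 0 → ¬ Surj W p →
    ∃ ε : ℤˣ, ∀ (κ : ZpExtension ℚ p) (γ : Field.absoluteGaloisGroup ℚ), κ.IsCyclotomic → κ.IsTopGenerator γ →
      IsCyclotomicVariable p γ → ∀ (D : SignedSelmerDualData W κ γ ε) (ξ : IwasawaAlgebra p),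
        D.charIdeal = Ideal.span {ξ} → mu ξ = 0 := by
  intro W _ _ p hpP hp5 hX hCM hap hs
  have hp : p ≠ 2 := by rintro rfl; exact absurd hp5 (by decide)
  exact stub_minSignAbsorption_ns stub_printedInputsFine_ns W p hp hX hCM hap hs (stub_conjA_ns_ge5 W p hp5 hX hCM hap hs)

/-- composition = THE SKELETON (v3): crux M `SmallImageMuZeroOneSign` BY NAME — at `p = 3` modularity (`hmodP`) gives the conductor-level
newform, the `p = 3` rider gives `(ε₀, L₀)` with a unit coefficient and the v1 brick gives M's body; at `p ≥ 5` the fine pivot gives it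
from Conjecture A.  No sorry of its own. [cite: Kobayashi2003, Conjecture (Main Conjecture) (p. 2), Thm. 1.2, Thm. 7.3 (7.21)]
[cite: CoatesSujatha2005, §3 Conjecture A] -/
theorem SmallImageMuZeroOneSign_of :
    Summit.BirchSwinnertonDyer.BirchSwinnertonDyer.Theses.SignedLowerHalves.SmallImageMuZeroOneSign := by
  intro W _ _ p hpP hp hX hCM hap hs
  by_cases hp5 : 5 ≤ p
  · exact muZeroOneSign_ge_five_of_stubs W p hp5 hX hCM hap hs
  · have h2 := hpP.out.two_le
    have hp3 : p = 3 := by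
      interval_cases p
      · exact absurd rfl hp
      · rfl
      · exact absurd hpP.out (by decide)
    obtain ⟨hCK, h12, h5, h3, hmodP⟩ := stub_printedInputsMu_ns
    haveI : NeZero (W.conductorNorm ℤ) := ⟨(W.conductorNorm_pos_holds).ne'⟩
    obtain ⟨f, hf⟩ := exists_isNewformOf_of_nonempty_modularParametrizationData hmodP W
    obtain ⟨ε, L₀, hL₀, hu₀⟩ := stub_muAnOneSignThree_ns W p hp3 hX hCM hap hs f hf
    exact ⟨ε, stub_muControl_ns ⟨hCK, h12, h5, h3⟩ W p hp hX hCM hap hs f hf ε L₀ hL₀ hu₀⟩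

/-- Certificate: the v2 open stub (retired item 23117, the one-signed ANALYTIC rider) is no longer on the line; for the record, its
statement (kept VERBATIM here as a `Prop`-valued abbreviation-free restatement is NOT needed) implied the new open stub at every pair through
lane B — see `SmallImageMuControl.mu_eq_zero_of_isSignedPAdicLFunction_of_hasUnitContent` (unit content ⟹ algebraic `μ(X^ε) = 0`) and
`SmallImageFinePivot.fineMuZeroAt_of_oneSignMuZero` (⟹ fine `μ = 0`).  This theorem records the latter composition at a pair:
M's body ⟹ `FineMuZeroAt`, modulo Kobayashi Thm. 1.2. [cite: Kobayashi2003, Thm. 1.2, (7.21)] [cite: CoatesSujatha2005, §3] -/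
theorem fineMuZeroAt_of_body (h12 : Literature.NumberTheory.EllipticCurves.Kobayashi2003.thm12_signedSelmerDual_finite_torsion)
    (W : WeierstrassCurve ℚ) [W.IsElliptic] [W.IsGloballyMinimal] (p : ℕ) [Fact p.Prime] (hp : p ≠ 2) (hX : ClassX7 W p)
    (hap : W.frobeniusTrace p = 0)
    (hM : ∃ ε : ℤˣ, ∀ (κ : ZpExtension ℚ p) (γ : Field.absoluteGaloisGroup ℚ), κ.IsCyclotomic → κ.IsTopGenerator γ →
      IsCyclotomicVariable p γ → ∀ (D : SignedSelmerDualData W κ γ ε) (ξ : IwasawaAlgebra p),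
        D.charIdeal = Ideal.span {ξ} → mu ξ = 0) :
    FineMuZeroAt W p :=
  Summit.BirchSwinnertonDyer.BirchSwinnertonDyer.Theorems.SmallImageFinePivot.fineMuZeroAt_of_oneSignMuZero h12 W hp hX.1.1 hap hM

end Summit.BirchSwinnertonDyer.BirchSwinnertonDyer.Cruxes.SmallImageMuZeroOneSign.BirthMu

end
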